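import Summits.BirchSwinnertonDyer.BirchSwinnertonDyer.Theorems.CMKolyvaginAtInertTwoCMKolyvaginConjectureAtInertTwoSelmerEigenTwistedCorestriction
import Summits.BirchSwinnertonDyer.BirchSwinnertonDyer.Theorems.CMKolyvaginAtInertTwoCMKolyvaginConjectureAtInertTwoTwinShaLawsOnStubFrame
import Literature.NumberTheory.EllipticCurves.TwoTorsionOddDegreeBaseChangeProofs
import Literature.NumberTheory.EllipticCurves.LeadingTermProofs
import HarnessLib

/-!
# Route `CMKolyvaginAtInertTwo`, crux `CMKolyvaginConjectureAtInertTwo` (stmt-BirchSwinnertonDyer-24648),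
# stub `stub_positiveDepth` — NO SELMER TRIGGER AT ANY DEPTH ON TWIN-`Ш`-TRIVIAL FRAMES (the SUFFICIENT road of census
# item (β₂) is EMPTY): `Ш(E^{(d_K)}/ℚ)[2^∞] = 0` (and the habitat's `rank E^{(d_K)}(ℚ) = 0`) ⟹ every `w(E)`-signed class of
# `Sel_{2^M}(E_K/K)` is `2`-torsion, so the trigger «`2^{M₀}·s ≠ 0`, `M₀ ≥ 1`» of hands 9/10 does not exist — depth ONE included

Seat `leafhand-bsd-cmkolyvaginatinert-11` g0 (cell `bsd-eis`); helper `--supports stmt-BirchSwinnertonDyer-24648`.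
THEOREMS ONLY: no definition, no named fact introduced, no `sorry`; no stub, crux or summit closed; BSD is proved
for no curve.  File 2 of this seat (file 1: `…SelmerEigenTwistedCorestriction`, the twisted corestriction law
`two_zsmul_eq_zero_of_selmer_eigen_of_twinShaTrivial`).

WHAT.  Hand 10's census split the research residue (β) of `stub_positiveDepth` («a SOURCE of the Selmer trigger
`s ∈ Sel_{2^M}(E_K/K)^{w(E)}` with `2^{M₀}·s ≠ 0`», hand 9's F3 §4 / hand 10's F1 §1) into (β₁) frames with
`Ш(E^{(d_K)}/ℚ)[2] ≠ 0` and (β₂) twin-`Ш`-trivial frames, proved (β₂) EMPTY at every depth `M₀ ≥ 2` (F2 §4: `4·s = 0`), and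
left depth one on (β₂) as «EXPECTED EMPTY by twisted corestriction — missing Lean lemma».  File 1 proved that lemma; this
file draws the consequences in the hands' currency:

* §1 `quadraticTwist_mordellWeilRank_eq_zero_of_rank_one` — `rank E_K(K) = 1 ∧ rank E(ℚ) = 1 ⟹ rank E^{(d_K)}(ℚ) = 0`
  (tree, PROVED: `mordellWeilRank_baseChange_quadratic_holds`, `rank E(K) = rank E(ℚ) + rank E^{(d_K)}(ℚ)`);
  `quadraticTwist_mordellWeilRank_eq_zero_onStubFrame` — on the stub's frame from the named facts `kolyvagin N_E W K`
  (hand 8's `mordellWeilRank_eq_one_of_derivedPoint_one_of_kolyvagin`: `rank E(K) = 1`) and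
  `rank_eq_analyticRank_of_analyticRank_le_one` (Gross–Zagier–Kolyvagin over `ℚ`: `r_an(E) = 1 ⟹ rank E(ℚ) = 1`).
* §2 ★ `pow_zsmul_eq_zero_of_selmer_eigen_of_one_le_of_twinShaTrivial` — `ρ̄_{E,2}` onto, `K` imaginary quadratic, `σ ≠ 1`,
  twin elliptic with `Ш(T/ℚ)[2^∞] = 0` and `rank T(ℚ) = 0`, `w(E) = −1`: **`2^{M₀}·s = 0` for EVERY `M₀ ≥ 1`** and every
  `w(E)`-signed `s ∈ Sel_{2^M}(E_K/K)` (file 1 §6; hand 10's F2 §4 had `M₀ ≥ 2` and the `ε`-line);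
  ★ `not_exists_selmerTrigger_of_twinShaTrivial` — hence **the trigger of hand 10's F1 §1 does not exist at ANY depth
  `M₀ ≥ 1`**: on (β₂) the SUFFICIENT (Kolyvagin-converse) road to a prime-level witness is CLOSED, depth one included; hand
  10's F2 §5 shape («`2·s = δ(x) ≠ 0`») is VACUOUS there (`two_zsmul_eq_zero_of_selmer_eigen_of_twinShaTrivial_of_surj`).
  NOT CLAIMED: that no prime-level WITNESS exists at depth one — a witness at a deep `ℓ` is a non-zero obstruction class
  `s_ℓ` (hands 5/9), which at `M₀ = 1` has order `2` and is allowed by `2·s = 0`; file 3 (one-bit law) excludes deep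
  prime-level witnesses only at depth `M₀ ≥ 2`.
* §3 the same IN THE STUB'S OWN CURRENCY, frame inputs discharged to named facts in hand 8/10's manner
  (`kolyvagin N_E W K`, parity bsd.S36 `even_analyticRank_iff_rootNumber_eq_one W`, GZK over `ℚ`
  `rank_eq_analyticRank_of_analyticRank_le_one`): `two_zsmul_eq_zero_of_selmer_eigen_onStubFrame_of_twinShaTrivial`,
  `pow_zsmul_eq_zero_of_selmer_eigen_onStubFrame_of_one_le_of_twinShaTrivial`,
  `not_exists_selmerTrigger_onStubFrame_of_twinShaTrivial`.

REPAIR CENSUS after this file (exact remaining list for `stub_positiveDepth`): on (β₂) frames the TRIGGER road is closed at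
every depth (this file) and (file 3) deep primes drop at most one bit, so at depth `M₀ ≥ 2` only (γ) — shallow primes
`M(ℓ) < M₀` / composite levels — can serve, while at depth `M₀ = 1` the prime-level question is exactly «some obstruction class
`s_ℓ = c_1(e) ∈ Sel_2(E_K/K)^{w}` is non-zero» (Kolyvagin's non-vanishing mod `2`, RESEARCH, not excluded by `2·s = 0`);
(β₁) — frames with `Ш(E^{(d_K)}/ℚ)[2] ≠ 0`: a `w(E)`-signed `š ∈ Ш(E_K)[2^M]` of order `≥ 2^{M₀}` lifting to `Sel_{2^M}(E_K/K)`
(hand 10's F1 §3 necessary / §1 sufficient; BSD₂-of-the-twin input, RESEARCH); (γ) the composite/shallow-level iteration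
(RESEARCH); (δ) the standing machine inputs at `2`.
HONEST FRAMING.  Compositions of file 1 with hands 8/10; the binders `hT0` (`Ш(E^{(d_K)}/ℚ)[2^∞] = 0`), `hρ2`, `hw`/parity,
`kolyvagin`, GZK are DISPLAYED; nothing here touches the research core of `stub_positiveDepth`; closes nothing; BSD is
proved for no curve.
References: [cite: Kramer1981, Thm. 1] [cite: GrossLMS1991, §1 Thm. 1.3, §5 (5.1), Prop. 5.3] [cite: Kolyvagin1990, Thm. A]
[cite: Darmon2004, Thm. 3.22] [cite: SilvermanAEC2009, C.16 Thm. 16.3] [cite: DokchitserDokchitserMathZ2012, Theorem (1)]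
presearch: composition of tree theorems only (file 1 + hands 8/10 + `LeadingTermProofs`); no new query needed.
-/

set_option autoImplicit false
set_option linter.dupNamespace false -- the Theorems namespace repeats the summit name by design (D-0017)

noncomputable section
open scoped Classical
open Field NumberField WeierstrassCurve
open Literature.NumberTheory.EllipticCurves
open Literature.NumberTheory.EllipticCurves.ModularForms
open Literature.NumberTheory.GaloisRepresentations
open Summit.BirchSwinnertonDyer.BirchSwinnertonDyer.Theorems.CMKolyvaginFirstDescentTwo
  (mordellWeilRank_eq_one_of_derivedPoint_one_of_kolyvagin)

namespace Summit.BirchSwinnertonDyer.BirchSwinnertonDyer.Theorems.CMKolyvaginFirstDescentTwoOnGivenFrame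

variable (W : WeierstrassCurve ℚ) [W.IsElliptic] {K : Type} [Field K] [NumberField K]

/-! ## §1 `rank E^{(d_K)}(ℚ) = 0` from `rank E(K) = 1 = rank E(ℚ)` -/

/-- **`rank E_K(K) = 1 ∧ rank E(ℚ) = 1 ⟹ rank E^{(d_K)}(ℚ) = 0`** for a quadratic field `K`: the tree's PROVED decomposition
`rank E(K) = rank E(ℚ) + rank E^{(d_K)}(ℚ)` (`mordellWeilRank_baseChange_quadratic_holds`). [cite: SilvermanAEC2009, X.§4]
[cite: GrossLMS1991, §5 (5.1)] -/
theorem quadraticTwist_mordellWeilRank_eq_zero_of_rank_one (h2 : Module.finrank ℚ K = 2)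
    (hK1 : (W.baseChange K).mordellWeilRank = 1) (hQ1 : W.mordellWeilRank = 1) :
    (W.quadraticTwist (NumberField.discr K : ℚ)).mordellWeilRank = 0 := by
  have h := mordellWeilRank_baseChange_quadratic_holds W K h2
  omega

/-- **On the stub's frame, `rank E^{(d_K)}(ℚ) = 0`** — `E/ℚ` with `r_an(E) = 1`, `K` imaginary quadratic with the Heegner
hypothesis, a conductor-`1` datum `d₁` with `P(1)` of infinite order; named facts: Kolyvagin's theorem `kolyvagin N_E W K`
(`rank E(K) = 1`, hand 8's `mordellWeilRank_eq_one_of_derivedPoint_one_of_kolyvagin`) and Gross–Zagier–Kolyvagin over `ℚ`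
`rank_eq_analyticRank_of_analyticRank_le_one` (`rank E(ℚ) = r_an(E) = 1`). [cite: Kolyvagin1990, Thm. A]
[cite: GrossLMS1991, §1 Thm. 1.3] [cite: Darmon2004, Thm. 3.22] -/
theorem quadraticTwist_mordellWeilRank_eq_zero_onStubFrame [W.IsGloballyMinimal] [NeZero (W.conductorNorm ℤ)]
    (hr : W.analyticRank = 1) (hK : IsImaginaryQuadratic K) (hHe : SatisfiesHeegnerHypothesis (W.conductorNorm ℤ) K)
    (hKoly : kolyvagin (W.conductorNorm ℤ) W K) (hGZK : rank_eq_analyticRank_of_analyticRank_le_one)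
    (Dt : ModularParametrizationData W (W.conductorNorm ℤ)) (β : ℤ) (ι : K →+* ℂ)
    (d₁ : KolyvaginHeegnerData Dt β ι 1) (hy : ¬ IsOfFinAddOrder d₁.derivedPoint) :
    (W.quadraticTwist (NumberField.discr K : ℚ)).mordellWeilRank = 0 := by
  refine quadraticTwist_mordellWeilRank_eq_zero_of_rank_one W hK.1
    (mordellWeilRank_eq_one_of_derivedPoint_one_of_kolyvagin W hKoly hK hHe Dt β ι d₁ hy).1 ?_
  rw [(hGZK W hr.le).1, hr]

/-! ## §2 ★ No Selmer trigger at any depth `M₀ ≥ 1` on twin-`Ш`-trivial frames -/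

/-- **`2·s = 0` for every `w(E)`-signed Selmer class, `ρ̄_{E,2}`-onto form.**  File 1 §6 with `E_K(K)[2] = 0` discharged by
`ρ̄_{E,2}` onto (tree `forall_two_nsmul_baseChange_of_hasSurjectiveModNGaloisRep_two_of_isImaginaryQuadratic`): `E = W/ℚ`,
`K` imaginary quadratic, `σ ≠ 1`, twin `T = E^{(d_K)}` elliptic with `Ш(T/ℚ)[2^∞] = 0` and `rank T(ℚ) = 0`, `w(E) = −1` ⟹
every `s ∈ Sel_{2^M}(E_K/K)` with `σ_* s = w(E)·s` has **`2·s = 0`**.  Hand 10's F2 §5 («depth-one trigger: `2·s = δ(x) ≠ 0`»)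
is therefore VACUOUS on such frames.  No `ε`-line is used. [cite: Kramer1981, Thm. 1] [cite: GrossLMS1991, §5 (5.1)] -/
theorem two_zsmul_eq_zero_of_selmer_eigen_of_twinShaTrivial_of_surj (hρ2 : W.HasSurjectiveModNGaloisRep 2)
    (hIQ : IsImaginaryQuadratic K) {σ : K ≃ₐ[ℚ] K} (hσ1 : σ ≠ 1)
    (hT0 : ∀ x ∈ AddCommGroup.primaryComponent (↥(W.quadraticTwist (NumberField.discr K : ℚ)).sha) 2, x = 0)
    (hTrk : (W.quadraticTwist (NumberField.discr K : ℚ)).mordellWeilRank = 0)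
    (hw : W.rootNumber = -1) {M : ℕ} {s : galH1Torsion (W.baseChange K) ((2 ^ M : ℕ) : ℤ)}
    (hs : s ∈ selmerGroup (W.baseChange K) ((2 ^ M : ℕ) : ℤ))
    (hsν : conjAct W σ ((2 ^ M : ℕ) : ℤ) s = W.rootNumber • s) :
    (2 : ℤ) • s = 0 := by
  haveI : (W.quadraticTwist (NumberField.discr K : ℚ)).IsElliptic :=
    W.isElliptic_quadraticTwist (by exact_mod_cast NumberField.discr_ne_zero K)
  exact two_zsmul_eq_zero_of_selmer_eigen_of_twinShaTrivial' W hIQ hσ1 hT0 hTrk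
    (fun P hP ↦ forall_two_nsmul_baseChange_of_hasSurjectiveModNGaloisRep_two_of_isImaginaryQuadratic W hρ2 K hIQ P
      (by rw [← natCast_zsmul]; exact_mod_cast hP)) hw hs hsν

/-- ★ **`2^{M₀}·s = 0` for EVERY `M₀ ≥ 1`** and every `w(E)`-signed `s ∈ Sel_{2^M}(E_K/K)`, on twin-`Ш`-trivial frames with
`rank E^{(d_K)}(ℚ) = 0` (same binders as `two_zsmul_eq_zero_of_selmer_eigen_of_twinShaTrivial_of_surj`).  Hand 10's F2 §4
had this for `M₀ ≥ 2` only, from the `ε`-line. [cite: Kramer1981, Thm. 1] [cite: GrossLMS1991, §5 (5.1), Prop. 5.3] -/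
theorem pow_zsmul_eq_zero_of_selmer_eigen_of_one_le_of_twinShaTrivial
    (hρ2 : W.HasSurjectiveModNGaloisRep 2) (hIQ : IsImaginaryQuadratic K) {σ : K ≃ₐ[ℚ] K} (hσ1 : σ ≠ 1)
    (hT0 : ∀ x ∈ AddCommGroup.primaryComponent (↥(W.quadraticTwist (NumberField.discr K : ℚ)).sha) 2, x = 0)
    (hTrk : (W.quadraticTwist (NumberField.discr K : ℚ)).mordellWeilRank = 0)
    (hw : W.rootNumber = -1) {M : ℕ} {s : galH1Torsion (W.baseChange K) ((2 ^ M : ℕ) : ℤ)}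
    (hs : s ∈ selmerGroup (W.baseChange K) ((2 ^ M : ℕ) : ℤ))
    (hsν : conjAct W σ ((2 ^ M : ℕ) : ℤ) s = W.rootNumber • s) {M₀ : ℕ} (hM₀ : 1 ≤ M₀) :
    (((2 : ℕ) : ℤ) ^ M₀) • s = 0 := by
  obtain ⟨j, rfl⟩ := Nat.exists_eq_add_of_le hM₀
  rw [add_comm, pow_add, pow_one, mul_smul, Nat.cast_ofNat,
    two_zsmul_eq_zero_of_selmer_eigen_of_twinShaTrivial_of_surj W hρ2 hIQ hσ1 hT0 hTrk hw hs hsν]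
  exact zsmul_zero _

/-- ★ **THE PRIME-LEVEL TRIGGER DOES NOT EXIST AT ANY DEPTH ON TWIN-`Ш`-TRIVIAL FRAMES.**  Same binders; then for every
`M₀ ≥ 1` and every level `2^M` there is NO `s ∈ Sel_{2^M}(E_K/K)` with `σ_* s = w(E)·s` and `2^{M₀}·s ≠ 0` — the hypothesis
of hand 10's F1 §1 `exists_kolyvaginHeegnerData_not_two_dvd_of_exactDepth_of_selmerTrigger_pow` (the SUFFICIENT, Kolyvagin-
converse road to the crux's conclusion) is never met there: the trigger source (β₂) is EMPTY at every depth, depth one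
included.  (A prime-level WITNESS at depth one — a non-zero order-`2` obstruction class — is not excluded by this.)
[cite: Kramer1981, Thm. 1] [cite: GrossLMS1991, §5 (5.1), Prop. 5.3] [cite: McCallumLMS1991, §5 Prop. 5.2, Thm. 5.4] -/
theorem not_exists_selmerTrigger_of_twinShaTrivial
    (hρ2 : W.HasSurjectiveModNGaloisRep 2) (hIQ : IsImaginaryQuadratic K) {σ : K ≃ₐ[ℚ] K} (hσ1 : σ ≠ 1)
    (hT0 : ∀ x ∈ AddCommGroup.primaryComponent (↥(W.quadraticTwist (NumberField.discr K : ℚ)).sha) 2, x = 0)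
    (hTrk : (W.quadraticTwist (NumberField.discr K : ℚ)).mordellWeilRank = 0)
    (hw : W.rootNumber = -1) (M : ℕ) {M₀ : ℕ} (hM₀ : 1 ≤ M₀) :
    ¬ ∃ s : galH1Torsion (W.baseChange K) ((2 ^ M : ℕ) : ℤ),
      s ∈ selmerGroup (W.baseChange K) ((2 ^ M : ℕ) : ℤ) ∧
        conjAct W σ ((2 ^ M : ℕ) : ℤ) s = W.rootNumber • s ∧ (((2 : ℕ) : ℤ) ^ M₀) • s ≠ 0 := by
  rintro ⟨s, hs, hsν, hne⟩
  exact hne (pow_zsmul_eq_zero_of_selmer_eigen_of_one_le_of_twinShaTrivial W hρ2 hIQ hσ1 hT0 hTrk hw hs hsν hM₀)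

/-! ## §3 In the stub's own currency (frame inputs → named facts, hand 8/10's manner) -/

/-- ★ **ON A TWIN-`Ш`-TRIVIAL FRAME OF `stub_positiveDepth`, EVERY `w(E)`-SIGNED SELMER CLASS IS `2`-TORSION.**  Binders of
the stub (`ρ̄_{E,2}` onto, `r_an = 1`; `K` imaginary quadratic, Heegner for `N_E`; `Dt, β, ι`, a conductor-`1` datum `d₁` with
`P(1)` of infinite order), the twin `E^{(d_K)}` elliptic with `Ш(E^{(d_K)}/ℚ)[2^∞] = 0`, and THREE named facts: Kolyvagin's theorem
`kolyvagin N_E W K`, parity bsd.S36 `even_analyticRank_iff_rootNumber_eq_one W`, GZK over `ℚ`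
`rank_eq_analyticRank_of_analyticRank_le_one`.  Then every `s ∈ Sel_{2^M}(E_K/K)` with `c_* s = w(E)·s` (`c ≠ 1`) has
`2·s = 0`.  Compare hand 10's F4 §2 (`4·s = 0`). [cite: Kolyvagin1990, Thm. A] [cite: GrossLMS1991, §1 Thm. 1.3, §5 (5.1)]
[cite: Kramer1981, Thm. 1] [cite: Darmon2004, Thm. 3.22] [cite: SilvermanAEC2009, C.16 Thm. 16.3] -/
theorem two_zsmul_eq_zero_of_selmer_eigen_onStubFrame_of_twinShaTrivial [W.IsGloballyMinimal]
    [NeZero (W.conductorNorm ℤ)] (hρ2 : W.HasSurjectiveModNGaloisRep 2)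
    (hr : W.analyticRank = 1) (hK : IsImaginaryQuadratic K) (hHe : SatisfiesHeegnerHypothesis (W.conductorNorm ℤ) K)
    (hKoly : kolyvagin (W.conductorNorm ℤ) W K) (hpar : even_analyticRank_iff_rootNumber_eq_one W)
    (hGZK : rank_eq_analyticRank_of_analyticRank_le_one)
    (hT0 : ∀ x ∈ AddCommGroup.primaryComponent (↥(W.quadraticTwist (NumberField.discr K : ℚ)).sha) 2, x = 0)
    (Dt : ModularParametrizationData W (W.conductorNorm ℤ)) (β : ℤ) (ι : K →+* ℂ)
    (d₁ : KolyvaginHeegnerData Dt β ι 1) (hy : ¬ IsOfFinAddOrder d₁.derivedPoint)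
    {c : K ≃ₐ[ℚ] K} (hc : c ≠ 1) {M : ℕ} {s : galH1Torsion (W.baseChange K) ((2 ^ M : ℕ) : ℤ)}
    (hs : s ∈ selmerGroup (W.baseChange K) ((2 ^ M : ℕ) : ℤ))
    (hsν : conjAct W c ((2 ^ M : ℕ) : ℤ) s = W.rootNumber • s) :
    (2 : ℤ) • s = 0 :=
  two_zsmul_eq_zero_of_selmer_eigen_of_twinShaTrivial_of_surj W hρ2 hK hc hT0
    (quadraticTwist_mordellWeilRank_eq_zero_onStubFrame W hr hK hHe hKoly hGZK Dt β ι d₁ hy)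
    (rootNumber_eq_neg_one_of_analyticRank_eq_one_of_parity W hpar hr) hs hsν

/-- ★ **Hence `2^{M₀}·s = 0` for EVERY `M₀ ≥ 1`** on the same stub frame (hand 10's F4 §2 had `M₀ ≥ 2`): the trigger of hand
10's F1 §1 does not exist on a twin-`Ш`-trivial frame of `stub_positiveDepth` at ANY depth. [cite: Kolyvagin1990, Thm. A]
[cite: Kramer1981, Thm. 1] [cite: GrossLMS1991, §5 (5.1)] -/
theorem pow_zsmul_eq_zero_of_selmer_eigen_onStubFrame_of_one_le_of_twinShaTrivial [W.IsGloballyMinimal]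
    [NeZero (W.conductorNorm ℤ)] (hρ2 : W.HasSurjectiveModNGaloisRep 2)
    (hr : W.analyticRank = 1) (hK : IsImaginaryQuadratic K) (hHe : SatisfiesHeegnerHypothesis (W.conductorNorm ℤ) K)
    (hKoly : kolyvagin (W.conductorNorm ℤ) W K) (hpar : even_analyticRank_iff_rootNumber_eq_one W)
    (hGZK : rank_eq_analyticRank_of_analyticRank_le_one)
    (hT0 : ∀ x ∈ AddCommGroup.primaryComponent (↥(W.quadraticTwist (NumberField.discr K : ℚ)).sha) 2, x = 0)
    (Dt : ModularParametrizationData W (W.conductorNorm ℤ)) (β : ℤ) (ι : K →+* ℂ)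
    (d₁ : KolyvaginHeegnerData Dt β ι 1) (hy : ¬ IsOfFinAddOrder d₁.derivedPoint)
    {c : K ≃ₐ[ℚ] K} (hc : c ≠ 1) {M : ℕ} {s : galH1Torsion (W.baseChange K) ((2 ^ M : ℕ) : ℤ)}
    (hs : s ∈ selmerGroup (W.baseChange K) ((2 ^ M : ℕ) : ℤ))
    (hsν : conjAct W c ((2 ^ M : ℕ) : ℤ) s = W.rootNumber • s) {M₀ : ℕ} (hM₀ : 1 ≤ M₀) :
    (((2 : ℕ) : ℤ) ^ M₀) • s = 0 :=
  pow_zsmul_eq_zero_of_selmer_eigen_of_one_le_of_twinShaTrivial W hρ2 hK hc hT0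
    (quadraticTwist_mordellWeilRank_eq_zero_onStubFrame W hr hK hHe hKoly hGZK Dt β ι d₁ hy)
    (rootNumber_eq_neg_one_of_analyticRank_eq_one_of_parity W hpar hr) hs hsν hM₀

/-- ★ **NO SELMER TRIGGER AT ANY DEPTH on a twin-`Ш`-trivial frame of `stub_positiveDepth`** (stub currency, `σ` = the
non-trivial automorphism of `K`, `exists_algEquiv_ne_one_of_isImaginaryQuadratic`): for every `M₀ ≥ 1`, every level `2^M`
and every `σ ≠ 1` there is no `s ∈ Sel_{2^M}(E_K/K)` with `σ_* s = w(E)·s`, `2^{M₀}·s ≠ 0`.  The trigger source (β₂) is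
EMPTY: the Kolyvagin-converse road to a prime-level witness is closed there at every depth (the depth-one WITNESS question —
a non-zero order-`2` obstruction class — stays open; at depth `≥ 2` file 3 leaves only (γ)).  [cite: Kolyvagin1990, Thm. A] [cite: Kramer1981, Thm. 1] [cite: GrossLMS1991, §5 (5.1), Prop. 5.3]
[cite: McCallumLMS1991, §5 Prop. 5.2, Thm. 5.4] -/
theorem not_exists_selmerTrigger_onStubFrame_of_twinShaTrivial [W.IsGloballyMinimal]
    [NeZero (W.conductorNorm ℤ)] (hρ2 : W.HasSurjectiveModNGaloisRep 2)
    (hr : W.analyticRank = 1) (hK : IsImaginaryQuadratic K) (hHe : SatisfiesHeegnerHypothesis (W.conductorNorm ℤ) K)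
    (hKoly : kolyvagin (W.conductorNorm ℤ) W K) (hpar : even_analyticRank_iff_rootNumber_eq_one W)
    (hGZK : rank_eq_analyticRank_of_analyticRank_le_one)
    (hT0 : ∀ x ∈ AddCommGroup.primaryComponent (↥(W.quadraticTwist (NumberField.discr K : ℚ)).sha) 2, x = 0)
    (Dt : ModularParametrizationData W (W.conductorNorm ℤ)) (β : ℤ) (ι : K →+* ℂ)
    (d₁ : KolyvaginHeegnerData Dt β ι 1) (hy : ¬ IsOfFinAddOrder d₁.derivedPoint)
    (M : ℕ) {M₀ : ℕ} (hM₀ : 1 ≤ M₀) :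
    ∀ σ : K ≃ₐ[ℚ] K, σ ≠ 1 →
      ¬ ∃ s : galH1Torsion (W.baseChange K) ((2 ^ M : ℕ) : ℤ),
        s ∈ selmerGroup (W.baseChange K) ((2 ^ M : ℕ) : ℤ) ∧
          conjAct W σ ((2 ^ M : ℕ) : ℤ) s = W.rootNumber • s ∧ (((2 : ℕ) : ℤ) ^ M₀) • s ≠ 0 :=
  fun _ hσ ↦ not_exists_selmerTrigger_of_twinShaTrivial W hρ2 hK hσ hT0
    (quadraticTwist_mordellWeilRank_eq_zero_onStubFrame W hr hK hHe hKoly hGZK Dt β ι d₁ hy)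
    (rootNumber_eq_neg_one_of_analyticRank_eq_one_of_parity W hpar hr) M hM₀

end Summit.BirchSwinnertonDyer.BirchSwinnertonDyer.Theorems.CMKolyvaginFirstDescentTwoOnGivenFrame

end
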